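import Literature.AnabelianGeometry.EtaleTheta.KummerDataOfCore
import Literature.AnabelianGeometry.EtaleTheta.SettingGaloisFacts
import Literature.AnabelianGeometry.EtaleTheta.ThetaCohomologySectionPoints
import HarnessLib

/-!
# Kummer data WITH `KddHat := H¹(G_K̈, Δ_Θ)` from a Kummer core and a Galois section — and the
# section-points of `Ÿ` it carries (non-vacuity of the [EtTh] §1 value layer at semi-synthetic models)

Mochizuki, *The étale theta function …*, Publ. RIMS **45** (2009) [EtTh], §1, Prop. 1.5 (i)/(ii) p. 23
("`F² = H¹(G_K, Δ_Θ) →̃ H¹(G_K, Ẑ(1)) →̃ (K^×)^∧`", "`F̈² = H¹(G_K̈, Δ_Θ) →̃ (K̈^×)^∧`"), Prop. 1.4 (iii)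
p. 22 (values at `K̈`-points), Def. 1.9 p. 29 [cite: MochizukiEtTh2009, Prop 1.5 p.23]. Layer L2 of the
abc-iut cell, seat abc-iut-L2-t6 (gen 5): R78 cluster hand #4 (the E-indexed VALUE layer, file map R100
F7), built OVER abc-iut-w5-d171's `KummerDataOfCore.lean` (F6: `KummerCore`, `KummerCore.toKummerData`)
and this seat's `ContH1ActionCongr.lean` / `ThetaCohomologySectionPoints.lean` — consumed BY NAME, nothing
restated; class (b) CONSTRUCTIONS of the frozen records `KummerData`, `NonCuspidalPoint`, `AnchoredPoint`;
no interface clause touched, no `Prop` fact.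

WHY A SECOND `KummerData` (design note F-t6g5-1 of this seat). `KummerCore.toKummerData` takes
`KddHat := K̈^×` (the `(Π^tp_Ÿ)^Θ`-invariant units — an honest SUB-object of print's `(K̈^×)^∧`). The frozen
field `NonCuspidalPoint.evalAt : H¹(D_y, Δ_Θ) →* KddHat` with `evalAt_kum` is a RETRACTION of the Kummer
map; at a section-point `D_y ≅ G_{ℚ_p}` of a model with non-trivial cyclotomic action, `H¹(D_y, Δ_Θ)` is a
`Ẑ`-module containing `Ẑ·κ(p)` and `Hom(Ẑ, ℤ) = 0`, so NO retraction onto `K̈^× ⊆ (K̈^×)^∧` exists and the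
point records would stay EMPTY. Print's carrier is the FULL `H¹(G_K̈, Δ_Θ) ≅ (K̈^×)^∧`; this file realises it.
GIVEN a continuous section `s : G_{ℚ_p} → Π^tp_X` of the augmentation (`aug ∘ s = id`) with
`s(G_K) ≤ Π^tp_Y`, `s(G_K̈) ≤ Π^tp_Ÿ` (e.g. `inr` of the semidirect-product models):
* `KummerCore.kumOfSection` — `H¹(H₀, Δ_Θ)` (computed through the section, action homomorphism
  `toTheta ∘ s`) `→ H¹(H, Δ_Θ)` for `H ≤ (Π^tp_X)^Θ` with `augTheta(H) ≤ H₀`: pull-back along `augTheta`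
  followed by the transport `ContH1.actionCongr` (the two conjugation actions on `Δ_Θ` agree because
  `Δ_Θ = coeffHom(Ẑ(1))` is acted on through `augTheta`: `conj_toTheta_section_augTheta`); INJECTIVE when
  `s` lands in `H` (`ContH1.comap_injective_of_section`);
* `KummerCore.toKummerDataOfSection` — `KHat := H¹(G_K, Δ_Θ)`, `KddHat := H¹(G_K̈, Δ_Θ)` (as
  `ContH1 (toTheta ∘ s) Δ_Θ G_K`, `… G_K̈`), `kumY`/`kumYdd := kumOfSection`, `toKHat`/`toKddHat :=` the
  core's Kummer classes pulled back along `s` (injective: re-inflating them returns the core's injective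
  `kumY ∘ toInvY`, since a Kummer cocycle factors through `augTheta` and `augTheta ∘ toTheta ∘ s = id` —
  `kumOfSection_pullback_kumY`), `hatIncl := res`, `res_kumY` by functoriality, `logU`/`logUdd` the core's;
* the SECTION-POINTS of this datum: `nonCuspidalPointOfCoreSection` (any unit off the cusps) via
  `ThetaCohomologySectionPoints` with the identity presentation (`heK` = the section retraction), and the
  census lemma `nonempty_nonCuspidalPoint_toKummerDataOfSection`; (v2) points and ANCHORED points at any
  OTHER section `s'` (`sectionPresentation` = `ContH1.actionCongr`, `comap_section'_inflTheta_kumYdd`,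
  `nonCuspidalPointOfSections`, `anchoredPointOfSections`) — the shape of the twisted sections `τ^{±1}`.
HONEST FRAMING: non-vacuity constructions for a semi-synthetic model; the two Kummer data (the core's and
this one) coexist; values of `η̈^Θ` at section-points are not the printed `Θ̈(Ü(y))`; typed ≠ proved; no side
is taken on [IUTchIII] Cor. 3.12.
-/

noncomputable section

namespace Literature.AnabelianGeometry.EtaleTheta

open Literature.AnabelianGeometry.SemiGraphs Literature.NumberTheory.GaloisRepresentations

namespace ThetaSetting

namespace KummerCore

variable {p : ℕ} [Fact p.Prime] {D : ThetaSetting p} (C : D.KummerCore)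
  (s : GQp p →* D.PiTemp) (hs : Continuous s) (hsec : ∀ σ : GQp p, D.aug (s σ) = σ)

/-! ### The conjugation action on `Δ_Θ` factors through `augTheta` -/

include hsec in
/-- **Conjugation on `Δ_Θ` through the section agrees with conjugation**: for `g ∈ (Π^tp_X)^Θ`,
`toTheta(s(augTheta g))` and `g` conjugate `Δ_Θ = coeffHom(Ẑ(1))` identically (equivariance of `coeffHom`,
`augTheta ∘ toTheta = aug`, `aug ∘ s = id`). [cite: MochizukiEtTh2009, Prop 1.5 p.23] -/
theorem conj_toTheta_section_augTheta (g : D.GtpTheta) (a : D.DeltaTheta) :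
    MulAut.conjNormal (D.toTheta (s (C.augTheta g))) a = MulAut.conjNormal g a := by
  obtain ⟨ζ, rfl⟩ := C.bijective_coeffHom.2 a
  rw [← C.coeffHom_smul, ← C.coeffHom_smul, C.augTheta_toTheta, hsec]

include hsec in
/-- The action-compatibility hypothesis of `ContH1.actionCongr` between the action homomorphisms
`(toTheta ∘ s) ∘ augTheta` and `id` of `(Π^tp_X)^Θ` on `Δ_Θ`. [cite: MochizukiEtTh2009, Prop 1.5 p.23] -/
theorem actionCompat (H : Subgroup D.GtpTheta) :
    ∀ g : D.GtpTheta, g ∈ H → ∀ a : D.DeltaTheta,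
      MulAut.conjNormal (((D.toTheta.comp s).comp C.augTheta) g) a =
        MulAut.conjNormal ((MonoidHom.id D.GtpTheta) g) a :=
  fun g _ a => C.conj_toTheta_section_augTheta s hsec g a

include hsec in
/-- `augTheta ∘ toTheta ∘ s = id`. [cite: MochizukiEtTh2009, Prop 1.5 p.23] -/
theorem augTheta_toTheta_section (σ : GQp p) : C.augTheta (D.toTheta (s σ)) = σ := by
  rw [C.augTheta_toTheta, hsec]

/-- The action of `(Π^tp_X)^Θ` on `ℚ̄_p^×` through `augTheta`, unfolded. [cite: MochizukiEtTh2009, Prop 1.3 p.21] -/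
theorem unitsAction_smul (g : D.GtpTheta) (r : (PadicAlgCl p)ˣ) :
    (letI := D.unitsAction C.augTheta; g • r) = C.augTheta g • r := rfl

/-! ### `H¹(H₀, Δ_Θ)` through the section `→ H¹(H, Δ_Θ)` -/

/-- **Inflation through the section**: `H¹(H₀, Δ_Θ) → H¹(H, Δ_Θ)` for `H ≤ (Π^tp_X)^Θ` with `augTheta(H) ≤ H₀`
— pull-back along `augTheta` then transport of the action homomorphism. [cite: MochizukiEtTh2009, Prop 1.5 p.23] -/
def kumOfSection (H : Subgroup D.GtpTheta) (H₀ : Subgroup (GQp p)) (hH : H.map C.augTheta ≤ H₀) :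
    ContH1 (D.toTheta.comp s) D.DeltaTheta H₀ →* D.H1Theta H :=
  (ContH1.actionCongr (φ := (D.toTheta.comp s).comp C.augTheta) (φ' := MonoidHom.id D.GtpTheta) (H := H)
      (C.actionCompat s hsec H)).toMonoidHom.comp
    (ContH1.comap (D.toTheta.comp s) D.DeltaTheta C.augTheta C.continuous_augTheta hH)

/-- `kumOfSection` on the class of a cocycle: precomposition with `toTheta ∘ s ∘ augTheta`… no — with
`augTheta` (the cocycle on `H₀` is evaluated at `augTheta h`). [cite: MochizukiEtTh2009, Prop 1.5 p.23] -/
theorem kumOfSection_mk (H : Subgroup D.GtpTheta) (H₀ : Subgroup (GQp p)) (hH : H.map C.augTheta ≤ H₀)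
    (f : H₀ → D.DeltaTheta) (hf : f ∈ contCocycles (D.toTheta.comp s) D.DeltaTheta H₀) :
    C.kumOfSection s hsec H H₀ hH (ContH1.mk f hf) =
      ContH1.mk (fun h => f ⟨C.augTheta h.1, hH ⟨h.1, h.2, rfl⟩⟩)
        ((contCocycles_congr (C.actionCompat s hsec H)) ▸
          (ContH1.comapCocycle (D.toTheta.comp s) D.DeltaTheta C.augTheta C.continuous_augTheta hH
            ⟨f, hf⟩).2) := rfl

include hs hsec in
/-- **`kumOfSection` is injective** when the section lands in `H` (`(toTheta ∘ s)(H₀) ≤ H`): `augTheta` then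
has the continuous section `toTheta ∘ s` over `H₀`. [cite: MochizukiEtTh2009, Prop 1.5 p.23] -/
theorem kumOfSection_injective (H : Subgroup D.GtpTheta) (H₀ : Subgroup (GQp p))
    (hH : H.map C.augTheta ≤ H₀) (hsH : H₀.map (D.toTheta.comp s) ≤ H) :
    Function.Injective (C.kumOfSection s hsec H H₀ hH) := by
  intro x y hxy
  have h : ContH1.comap (D.toTheta.comp s) D.DeltaTheta C.augTheta C.continuous_augTheta hH x =
      ContH1.comap (D.toTheta.comp s) D.DeltaTheta C.augTheta C.continuous_augTheta hH y :=
    (ContH1.actionCongr (H := H) (C.actionCompat s hsec H)).injective hxy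
  exact ContH1.comap_injective_of_section (D.toTheta.comp s) D.DeltaTheta C.augTheta C.continuous_augTheta
    (D.toTheta.comp s) (D.continuous_toTheta.comp hs) (fun g _ => C.augTheta_toTheta_section s hsec g)
    hsH hH h

/-- `kumOfSection` commutes with restriction. [cite: MochizukiEtTh2009, Prop 1.5 p.23] -/
theorem res_kumOfSection {H H' : Subgroup D.GtpTheta} {H₀ H₀' : Subgroup (GQp p)} (hH : H.map C.augTheta ≤ H₀)
    (hH' : H'.map C.augTheta ≤ H₀') (hle : H' ≤ H) (hle₀ : H₀' ≤ H₀)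
    (x : ContH1 (D.toTheta.comp s) D.DeltaTheta H₀) :
    ContH1.res (MonoidHom.id D.GtpTheta) D.DeltaTheta hle (C.kumOfSection s hsec H H₀ hH x) =
      C.kumOfSection s hsec H' H₀' hH' (ContH1.res (D.toTheta.comp s) D.DeltaTheta hle₀ x) := by
  induction x using QuotientGroup.induction_on with
  | H f => rfl

/-! ### The core's Kummer classes pulled back along the section, and the retraction -/

section Pullback

variable (hsY : D.GK.map s ≤ D.GtpY) (hsYdd : D.GKdd.map s ≤ D.GtpYdd)

/-- `K^× → H¹(G_K, Δ_Θ)`: the core's Kummer class `κ(u)` on `(Π^tp_Y)^Θ`, inflated to `Π^tp_Y` and pulled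
back along `s`. [cite: MochizukiEtTh2009, Prop 1.5 p.23] -/
def toKHatOfSection : (↥D.K)ˣ →* ContH1 (D.toTheta.comp s) D.DeltaTheta D.GK :=
  ((ContH1.comap D.toTheta D.DeltaTheta s hs hsY).comp (D.inflTheta D.GtpY)).comp
    (C.toKummerData.kumY.comp C.toKummerData.toKHat)

/-- `K̈^× → H¹(G_K̈, Δ_Θ)` likewise. [cite: MochizukiEtTh2009, Prop 1.5 p.23] -/
def toKddHatOfSection : (↥D.Kdd)ˣ →* ContH1 (D.toTheta.comp s) D.DeltaTheta D.GKdd :=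
  ((ContH1.comap D.toTheta D.DeltaTheta s hs hsYdd).comp (D.inflTheta D.GtpYdd)).comp
    (C.toKummerData.kumYdd.comp C.toKummerData.toKddHat)

include hsec in
/-- **The retraction** (`Y`): re-inflating the pulled-back Kummer class of `u ∈ K^×` through the section
returns the core's class `κ(u)` on `(Π^tp_Y)^Θ` — a Kummer cocycle factors through `augTheta`, and
`augTheta ∘ toTheta ∘ s = id`. [cite: MochizukiEtTh2009, Prop 1.5 p.23] -/
theorem kumOfSection_toKHatOfSection (u : (↥D.K)ˣ) :
    C.kumOfSection s hsec (D.GtpY.map D.toTheta) D.GK C.map_augTheta_gtpY.le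
        (C.toKHatOfSection s hs hsY u) =
      C.toKummerData.kumY (C.toKummerData.toKHat u) := by
  letI := D.unitsAction C.augTheta
  -- unfold the core's Kummer class as the class of a Kummer cocycle
  change C.kumOfSection s hsec _ _ _ (ContH1.comap D.toTheta D.DeltaTheta s hs hsY
      (D.inflTheta D.GtpY (C.coeff.kummerContMap (D.GtpY.map D.toTheta) C.isOpen_stabilizer' (C.toInvY u)))) =
    C.coeff.kummerContMap (D.GtpY.map D.toTheta) C.isOpen_stabilizer' (C.toInvY u)
  rw [C.coeff.kummerContMap_apply_eq _ C.isOpen_stabilizer' (C.toInvY u)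
    (RootSystem.ofRootableBy ((C.toInvY u : C.invY) : (PadicAlgCl p)ˣ))]
  unfold CyclotomeCoefficients.kummerContClass
  change ContH1.mk _ _ = ContH1.mk _ _
  refine ContH1.mk_congr _ (funext fun h => ?_) _ _
  change C.coeff.hom (RootSystem.kummerCocycle _ _ ⟨D.toTheta (s (C.augTheta h.1)), _⟩) =
    C.coeff.hom (RootSystem.kummerCocycle _ _ h)
  congr 1
  refine Subtype.ext (funext fun n => ?_)
  simp only [RootSystem.kummerCocycle_apply, Subgroup.smul_def, unitsAction_smul]
  rw [C.augTheta_toTheta_section s hsec]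

include hsec in
/-- The retraction (`Ÿ`). [cite: MochizukiEtTh2009, Prop 1.5 p.23] -/
theorem kumOfSection_toKddHatOfSection (u : (↥D.Kdd)ˣ) :
    C.kumOfSection s hsec (D.GtpYdd.map D.toTheta) D.GKdd C.map_augTheta_gtpYdd.le
        (C.toKddHatOfSection s hs hsYdd u) =
      C.toKummerData.kumYdd (C.toKummerData.toKddHat u) := by
  letI := D.unitsAction C.augTheta
  change C.kumOfSection s hsec _ _ _ (ContH1.comap D.toTheta D.DeltaTheta s hs hsYdd
      (D.inflTheta D.GtpYdd (C.coeff.kummerContMap (D.GtpYdd.map D.toTheta) C.isOpen_stabilizer'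
        (C.toInvYdd u)))) =
    C.coeff.kummerContMap (D.GtpYdd.map D.toTheta) C.isOpen_stabilizer' (C.toInvYdd u)
  rw [C.coeff.kummerContMap_apply_eq _ C.isOpen_stabilizer' (C.toInvYdd u)
    (RootSystem.ofRootableBy ((C.toInvYdd u : C.invYdd) : (PadicAlgCl p)ˣ))]
  unfold CyclotomeCoefficients.kummerContClass
  change ContH1.mk _ _ = ContH1.mk _ _
  refine ContH1.mk_congr _ (funext fun h => ?_) _ _
  change C.coeff.hom (RootSystem.kummerCocycle _ _ ⟨D.toTheta (s (C.augTheta h.1)), _⟩) =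
    C.coeff.hom (RootSystem.kummerCocycle _ _ h)
  congr 1
  refine Subtype.ext (funext fun n => ?_)
  simp only [RootSystem.kummerCocycle_apply, Subgroup.smul_def, unitsAction_smul]
  rw [C.augTheta_toTheta_section s hsec]

include hsec in
/-- `toKHatOfSection` is injective (its re-inflation is the core's injective `kumY ∘ toKHat`).
[cite: MochizukiEtTh2009, Prop 1.5 p.23] -/
theorem toKHatOfSection_injective : Function.Injective (C.toKHatOfSection s hs hsY) := by
  intro u v h
  have h' := congrArg (C.kumOfSection s hsec (D.GtpY.map D.toTheta) D.GK C.map_augTheta_gtpY.le) h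
  rw [C.kumOfSection_toKHatOfSection s hs hsec hsY, C.kumOfSection_toKHatOfSection s hs hsec hsY] at h'
  exact C.toKummerData.toKHat_injective (C.toKummerData.kumY_injective h')

include hsec in
/-- `toKddHatOfSection` is injective. [cite: MochizukiEtTh2009, Prop 1.5 p.23] -/
theorem toKddHatOfSection_injective : Function.Injective (C.toKddHatOfSection s hs hsYdd) := by
  intro u v h
  have h' := congrArg
    (C.kumOfSection s hsec (D.GtpYdd.map D.toTheta) D.GKdd C.map_augTheta_gtpYdd.le) h
  rw [C.kumOfSection_toKddHatOfSection s hs hsec hsYdd, C.kumOfSection_toKddHatOfSection s hs hsec hsYdd] at h'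
  exact C.toKummerData.toKddHat_injective (C.toKummerData.kumYdd_injective h')

/-- Compatibility of the two pull-backs with `K^× ⊆ K̈^×` and restriction `G_K̈ ≤ G_K`.
[cite: MochizukiEtTh2009, Prop 1.5 p.23] -/
theorem res_toKHatOfSection (x : (↥D.K)ˣ) (y : (↥D.Kdd)ˣ)
    (hxy : ((x : D.K) : PadicAlgCl p) = ((y : D.Kdd) : PadicAlgCl p)) :
    ContH1.res (D.toTheta.comp s) D.DeltaTheta D.GKdd_le_GK (C.toKHatOfSection s hs hsY x) =
      C.toKddHatOfSection s hs hsYdd y := by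
  have hincl : C.toKummerData.hatIncl (C.toKummerData.toKHat x) = C.toKummerData.toKddHat y :=
    C.toKummerData.hatIncl_toKHat x y hxy
  change ContH1.res (D.toTheta.comp s) D.DeltaTheta D.GKdd_le_GK
      (ContH1.comap D.toTheta D.DeltaTheta s hs hsY
        (D.inflTheta D.GtpY (C.toKummerData.kumY (C.toKummerData.toKHat x)))) =
    ContH1.comap D.toTheta D.DeltaTheta s hs hsYdd
      (D.inflTheta D.GtpYdd (C.toKummerData.kumYdd (C.toKummerData.toKddHat y)))
  rw [← hincl, ← C.toKummerData.res_kumY]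
  generalize C.toKummerData.kumY (C.toKummerData.toKHat x) = z
  induction z using QuotientGroup.induction_on with
  | H f => rfl

end Pullback

/-! ### The Kummer datum with `KddHat := H¹(G_K̈, Δ_Θ)` -/

/-- **Kummer data with the FULL carrier** `KHat := H¹(G_K, Δ_Θ)`, `KddHat := H¹(G_K̈, Δ_Θ)` (computed through
the Galois section `s`), over a Kummer core: print's "`F² = H¹(G_K, Δ_Θ) ≅ (K^×)^∧`" taken as the carrier —
the one on which points of `Ÿ` can be evaluated. [cite: MochizukiEtTh2009, Prop 1.5 p.23] -/
def toKummerDataOfSection (hsY : D.GK.map s ≤ D.GtpY)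
    (hsYdd : D.GKdd.map s ≤ D.GtpYdd) : D.KummerData where
  KHat := ContH1 (D.toTheta.comp s) D.DeltaTheta D.GK
  KddHat := ContH1 (D.toTheta.comp s) D.DeltaTheta D.GKdd
  toKHat := C.toKHatOfSection s hs hsY
  toKddHat := C.toKddHatOfSection s hs hsYdd
  toKHat_injective := C.toKHatOfSection_injective s hs hsec hsY
  toKddHat_injective := C.toKddHatOfSection_injective s hs hsec hsYdd
  hatIncl := ContH1.res (D.toTheta.comp s) D.DeltaTheta D.GKdd_le_GK
  hatIncl_toKHat := C.res_toKHatOfSection s hs hsY hsYdd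
  kumY := C.kumOfSection s hsec (D.GtpY.map D.toTheta) D.GK C.map_augTheta_gtpY.le
  kumY_injective := C.kumOfSection_injective s hs hsec _ _ _
    (by rw [← Subgroup.map_map]; exact Subgroup.map_mono hsY)
  kumYdd := C.kumOfSection s hsec (D.GtpYdd.map D.toTheta) D.GKdd C.map_augTheta_gtpYdd.le
  kumYdd_injective := C.kumOfSection_injective s hs hsec _ _ _
    (by rw [← Subgroup.map_map]; exact Subgroup.map_mono hsYdd)
  res_kumY x := C.res_kumOfSection s hsec _ _ D.GtpYddTheta_le D.GKdd_le_GK x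
  logU := C.logU
  logUdd := C.logUdd
  res_logU := C.res_logU

/-- The `Ÿ`-Kummer map of the section datum, unfolded. [cite: MochizukiEtTh2009, Prop 1.5 p.23] -/
theorem toKummerDataOfSection_kumYdd (hsY : D.GK.map s ≤ D.GtpY)
    (hsYdd : D.GKdd.map s ≤ D.GtpYdd)
    (c : ContH1 (D.toTheta.comp s) D.DeltaTheta D.GKdd) :
    (C.toKummerDataOfSection s hs hsec hsY hsYdd).kumYdd c =
      C.kumOfSection s hsec (D.GtpYdd.map D.toTheta) D.GKdd C.map_augTheta_gtpYdd.le c := rfl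

/-! ### The section-points of the datum -/

include hsec in
/-- **The presentation hypothesis `heK` of `ThetaCohomologySectionPoints` holds with `eK := refl`**: pulling
`infl (kumYdd c)` back along `s` over `G_K̈` returns `c` (section retraction `ContH1.comap_section_comap'`).
[cite: MochizukiEtTh2009, Prop 1.4 (iii) p.22] -/
theorem comap_section_inflTheta_kumYdd (hsY : D.GK.map s ≤ D.GtpY)
    (hsYdd : D.GKdd.map s ≤ D.GtpYdd)
    (c : ContH1 (D.toTheta.comp s) D.DeltaTheta D.GKdd) :
    ContH1.comap D.toTheta D.DeltaTheta s hs hsYdd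
        (D.inflTheta D.GtpYdd ((C.toKummerDataOfSection s hs hsec hsY hsYdd).kumYdd c)) =
      (MulEquiv.refl _) c := by
  induction c using QuotientGroup.induction_on with
  | H f =>
    change ContH1.mk _ _ = ContH1.mk _ _
    refine ContH1.mk_congr _ (funext fun h => ?_) _ _
    change f.1 ⟨C.augTheta (D.toTheta (s h.1)), _⟩ = f.1 h
    exact congrArg f.1 (Subtype.ext (C.augTheta_toTheta_section s hsec h.1))

/-- **A non-cuspidal section-point of `Ÿ` for the section datum** (the untwisted section itself as `D_y`,
coordinate any unit off the cusps) — so `NonCuspidalPoint` is INHABITED for `toKummerDataOfSection`.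
[cite: MochizukiEtTh2009, Prop 1.4 (iii) p.22] -/
def nonCuspidalPointOfCoreSection (hsY : D.GK.map s ≤ D.GtpY)
    (hsYdd : D.GKdd.map s ≤ D.GtpYdd) (u : (↥D.Kdd)ˣ)
    (hu : ∀ a : ℤ, ((u : D.Kdd) : PadicAlgCl p) ≠ D.qdd ^ a ∧ ((u : D.Kdd) : PadicAlgCl p) ≠ -(D.qdd ^ a)) :
    NonCuspidalPoint (C.toKummerDataOfSection s hs hsec hsY hsYdd) :=
  (C.toKummerDataOfSection s hs hsec hsY hsYdd).nonCuspidalPointOfSection s hs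
    (fun g _ => hsec g) hsYdd (MulEquiv.refl _)
    (C.comap_section_inflTheta_kumYdd s hs hsec hsY hsYdd) u hu

/-- **Census**: with a Kummer core, a Galois section and one unit of `K̈` off `±q̈^ℤ`, BOTH `KummerData` and
`NonCuspidalPoint` are inhabited (the latter for the section datum). [cite: MochizukiEtTh2009, Prop 1.4 (iii) p.22] -/
theorem nonempty_nonCuspidalPoint_toKummerDataOfSection (hsY : D.GK.map s ≤ D.GtpY)
    (hsYdd : D.GKdd.map s ≤ D.GtpYdd)
    (hu : ∃ u : (↥D.Kdd)ˣ, ∀ a : ℤ, ((u : D.Kdd) : PadicAlgCl p) ≠ D.qdd ^ a ∧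
      ((u : D.Kdd) : PadicAlgCl p) ≠ -(D.qdd ^ a)) :
    Nonempty (NonCuspidalPoint (C.toKummerDataOfSection s hs hsec hsY hsYdd)) := by
  obtain ⟨u, hu⟩ := hu
  exact ⟨C.nonCuspidalPointOfCoreSection s hs hsec hsY hsYdd u hu⟩

/-! ### Points of the section datum at OTHER sections (v2, abc-iut-L2-t6 gen 5)

The datum `toKummerDataOfSection s` fixes its carrier `H¹(G_K̈, Δ_Θ)` through ONE section `s` (the Galois
factor); the points `τ`, `τ⁻¹` of Def. 1.9 are OTHER sections `s'` (twisted along `Δ^tp`). Since every section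
induces the same conjugation on `Δ_Θ` (it factors through `augTheta`), the carrier is presented through `s'` by
`ContH1.actionCongr`, and the section retraction holds for `s'` as well. -/

section OtherSection

variable (hsec : ∀ σ : GQp p, D.aug (s σ) = σ) (hsY : D.GK.map s ≤ D.GtpY) (hsYdd : D.GKdd.map s ≤ D.GtpYdd)
  (s' : GQp p →* D.PiTemp) (hs' : Continuous s') (hsec' : ∀ σ : GQp p, D.aug (s' σ) = σ)
  (hsYdd' : D.GKdd.map s' ≤ D.GtpYdd)

include C hsec hsec' in
/-- Two sections of the augmentation induce the SAME conjugation action on `Δ_Θ` (both factor through `augTheta`).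
[cite: MochizukiEtTh2009, Prop 1.5 p.23] -/
theorem actionCompat_sections (H₀ : Subgroup (GQp p)) :
    ∀ σ : GQp p, σ ∈ H₀ → ∀ a : D.DeltaTheta,
      MulAut.conjNormal ((D.toTheta.comp s) σ) a = MulAut.conjNormal ((D.toTheta.comp s') σ) a := by
  intro σ _ a
  have h := C.conj_toTheta_section_augTheta s hsec (D.toTheta (s' σ)) a
  rw [C.augTheta_toTheta_section s' hsec'] at h
  exact h

include hsec' in
/-- **The carrier of the section datum presented through another section** `s'`:
`H¹(G_K̈, Δ_Θ)` (via `s`) `≃* H¹(G_K̈, Δ_Θ)` (via `s'`). [cite: MochizukiEtTh2009, Prop 1.4 (iii) p.22] -/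
def sectionPresentation : (C.toKummerDataOfSection s hs hsec hsY hsYdd).KddHat ≃*
    ContH1 (D.toTheta.comp s') D.DeltaTheta D.GKdd :=
  ContH1.actionCongr (H := D.GKdd) (C.actionCompat_sections s hsec s' hsec' D.GKdd)

include hsec' in
/-- **The presentation hypothesis `heK` at the section `s'`**: pulling `infl (kumYdd c)` back along `s'` over `G_K̈`
returns `c` read through `sectionPresentation s'`. [cite: MochizukiEtTh2009, Prop 1.4 (iii) p.22] -/
theorem comap_section'_inflTheta_kumYdd (c : ContH1 (D.toTheta.comp s) D.DeltaTheta D.GKdd) :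
    ContH1.comap D.toTheta D.DeltaTheta s' hs' hsYdd'
        (D.inflTheta D.GtpYdd ((C.toKummerDataOfSection s hs hsec hsY hsYdd).kumYdd c)) =
      C.sectionPresentation s hs hsec hsY hsYdd s' hsec' c := by
  induction c using QuotientGroup.induction_on with
  | H f =>
    change ContH1.mk _ _ = ContH1.mk _ _
    refine ContH1.mk_congr _ (funext fun h => ?_) _ _
    change f.1 ⟨C.augTheta (D.toTheta (s' h.1)), _⟩ = f.1 h
    exact congrArg f.1 (Subtype.ext (C.augTheta_toTheta_section s' hsec' h.1))

include hsec' in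
/-- **A point of the section datum at ANY other section** `s'` with `s'(G_K̈) ≤ Π^tp_Ÿ` (e.g. a section twisted
along `Δ^tp_Ÿ`), coordinate any unit off the cusps. [cite: MochizukiEtTh2009, Prop 1.4 (iii) p.22] -/
def nonCuspidalPointOfSections (u : (↥D.Kdd)ˣ)
    (hu : ∀ a : ℤ, ((u : D.Kdd) : PadicAlgCl p) ≠ D.qdd ^ a ∧ ((u : D.Kdd) : PadicAlgCl p) ≠ -(D.qdd ^ a)) :
    NonCuspidalPoint (C.toKummerDataOfSection s hs hsec hsY hsYdd) :=
  (C.toKummerDataOfSection s hs hsec hsY hsYdd).nonCuspidalPointOfSection s' hs' (fun g _ => hsec' g) hsYdd'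
    (C.sectionPresentation s hs hsec hsY hsYdd s' hsec')
    (C.comap_section'_inflTheta_kumYdd s hs hsec hsY hsYdd s' hs' hsec' hsYdd') u hu

include hsec' in
/-- **An ANCHORED point of the section datum at another section** `s'`: the anchor `log(Ü)|_{s'} = Ü(y)` is the
hypothesis `hanch` — pulling the core's `log(Ü)` back along `s'` gives the (transported) pulled-back Kummer class
of `u` (in the χ-twisted model: `s'` = the Galois factor twisted by `κ_u²` along the `b`-axis, `log(Ü) = y/2`).
[cite: MochizukiEtTh2009, Prop 1.4 (iii) p.22] -/
def anchoredPointOfSections (u : (↥D.Kdd)ˣ)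
    (hu : ∀ a : ℤ, ((u : D.Kdd) : PadicAlgCl p) ≠ D.qdd ^ a ∧ ((u : D.Kdd) : PadicAlgCl p) ≠ -(D.qdd ^ a))
    (hanch : ContH1.comap D.toTheta D.DeltaTheta s' hs' hsYdd' (D.inflTheta D.GtpYdd C.logUdd) =
      C.sectionPresentation s hs hsec hsY hsYdd s' hsec' (C.toKddHatOfSection s hs hsYdd u)) :
    AnchoredPoint (C.toKummerDataOfSection s hs hsec hsY hsYdd) :=
  (C.toKummerDataOfSection s hs hsec hsY hsYdd).anchoredPointOfSection s' hs' (fun g _ => hsec' g) hsYdd'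
    (C.sectionPresentation s hs hsec hsY hsYdd s' hsec')
    (C.comap_section'_inflTheta_kumYdd s hs hsec hsY hsYdd s' hs' hsec' hsYdd') u hu hanch

/-- The decomposition group of such a point is `s'(G_K̈)`. [cite: MochizukiEtTh2009, Prop 1.4 (iii) p.22] -/
@[simp] theorem Dpt_nonCuspidalPointOfSections (u : (↥D.Kdd)ˣ)
    (hu : ∀ a : ℤ, ((u : D.Kdd) : PadicAlgCl p) ≠ D.qdd ^ a ∧ ((u : D.Kdd) : PadicAlgCl p) ≠ -(D.qdd ^ a)) :
    (C.nonCuspidalPointOfSections s hs hsec hsY hsYdd s' hs' hsec' hsYdd' u hu).Dpt = D.GKdd.map s' := rfl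

/-- … and its coordinate is `u`. [cite: MochizukiEtTh2009, Prop 1.4 (iii) p.22] -/
@[simp] theorem coord_nonCuspidalPointOfSections (u : (↥D.Kdd)ˣ)
    (hu : ∀ a : ℤ, ((u : D.Kdd) : PadicAlgCl p) ≠ D.qdd ^ a ∧ ((u : D.Kdd) : PadicAlgCl p) ≠ -(D.qdd ^ a)) :
    (C.nonCuspidalPointOfSections s hs hsec hsY hsYdd s' hs' hsec' hsYdd' u hu).coord = u := rfl

end OtherSection

end KummerCore

end ThetaSetting

end Literature.AnabelianGeometry.EtaleTheta

end
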